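import Literature.AlgebraicGeometry.Frobenioids.ArchimedeanProp35iiiStdBase
import HarnessLib

/-!
# The four-object base `S`: connected, totally epimorphic, of FSM-type; `f : b → a` is a mono-minimal categorical
# quotient of `b` by `Aut(b)`

Mochizuki, *The geometry of Frobenioids II: poly-Frobenioids*, Kyushu J. Math. **62** (2008) 401–460, §3,
Proposition 3.5 (iii) p. 34 [cite: MochizukiFrdII2008, Prop 3.5 (iii) p.34]; [FrdI] §0 pp. 14–18 (fiberwise-surjective /
FSM-morphisms, categories of FSM-type, categorical quotients, mono-minimality) [cite: MochizukiFrdI2008, §0 p.18].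

PROOF-ONLY companion of `ArchimedeanProp35iiiStdBase.lean` (abc-iut cell, layer L1, node `FrdII:Prop3.5(iii)`, sub-row
P35iii-STD; seat abc-iut-w4-d027 gen 3). PROVED: `S.isGraphConnected`, `S.isTotallyEpimorphic`,
`S.isCategoricalQuotient_fHom` / `S.isMonoMinimalQuotient_fHom` (`f : b → a` is a mono-minimal categorical quotient of
`b` by the full group `Aut(b)`: no arrow `b → b` is `σ`-invariant, `Hom(b, a) = {f}`, `End(a) = 1`, and `f` is not
mono), `S.isOfFSMType` (every FSM-morphism is an isomorphism: the non-invertible monomorphisms — the arrows out of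
`d` — are not fiberwise surjective). No definitions; nothing here bears on [IUTchIII] Cor. 3.12.
-/

namespace Literature.AlgebraicGeometry.Frobenioids

open CategoryTheory

noncomputable section

namespace ArchFrd

namespace P35iiiStd

namespace S

/-- Left cancellation of `xor`. [folklore] -/
private theorem xor_cancel_left {s c c' : Bool} (h : xor s c = xor s c') : c = c' := by
  revert s c c'
  decide

/-- `xor true s ≠ s`. [folklore] -/
private theorem true_xor_ne (s : Bool) : xor true s ≠ s := by
  cases s <;> decide

/-- `S` is connected (every object maps from `d` or receives from it through `b`, `c`).
[cite: MochizukiFrdII2008, Prop 3.5 (iii) p.34] -/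
theorem isGraphConnected : IsGraphConnected S := by
  refine ⟨⟨a⟩, fun X Y => ?_⟩
  have h : ∀ K : S, Zigzag d K := fun K => by
    cases K
    · exact Zigzag.of_hom (Hom.r .pf)
    · exact Zigzag.of_hom (pHom false)
    · exact Zigzag.of_hom (qHom false)
    · exact Zigzag.refl _
  exact (h X).symm.trans (h Y)

/-- `S` is connected in Mathlib's sense. [cite: MochizukiFrdII2008, Prop 3.5 (iii) p.34] -/
theorem isConnected : IsConnected S := isGraphConnected_iff_isConnected.mp isGraphConnected

/-- `S` is totally epimorphic. [cite: MochizukiFrdII2008, Prop 3.5 (iii) p.34] -/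
theorem isTotallyEpimorphic : IsTotallyEpimorphic S := by
  refine ⟨fun {X Y} φ => ⟨fun {Z} g g' hgg => ?_⟩⟩
  cases φ with
  | autB s =>
    cases Z
    · exact Subsingleton.elim _ _
    · obtain ⟨s₁, rfl⟩ := hom_bb_eq g
      obtain ⟨s₂, rfl⟩ := hom_bb_eq g'
      have e : Hom.autB (xor s s₁) = Hom.autB (xor s s₂) := hgg
      rw [xor_cancel_left (Hom.autB.inj e)]
    · exact (isEmpty_hom_bc.false g).elim
    · exact (isEmpty_hom_bd.false g).elim
  | autC t =>
    cases Z
    · obtain ⟨k₁, rfl⟩ := hom_ca_eq g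
      obtain ⟨k₂, rfl⟩ := hom_ca_eq g'
      have e : Hom.h k₁ = Hom.h k₂ := hgg
      rw [Hom.h.inj e]
    · exact (isEmpty_hom_cb.false g).elim
    · obtain ⟨t₁, rfl⟩ := hom_cc_eq g
      obtain ⟨t₂, rfl⟩ := hom_cc_eq g'
      have e : Hom.autC (xor t t₁) = Hom.autC (xor t t₂) := hgg
      rw [xor_cancel_left (Hom.autC.inj e)]
    · exact (isEmpty_hom_cd.false g).elim
  | ida => exact (cancel_epi (𝟙 a)).mp hgg
  | idd => exact (cancel_epi (𝟙 d)).mp hgg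
  | f =>
    cases Z
    · exact Subsingleton.elim _ _
    · exact (isEmpty_hom_ab.false g).elim
    · exact (isEmpty_hom_ac.false g).elim
    · exact (isEmpty_hom_ad.false g).elim
  | h k =>
    cases Z
    · exact Subsingleton.elim _ _
    · exact (isEmpty_hom_ab.false g).elim
    · exact (isEmpty_hom_ac.false g).elim
    · exact (isEmpty_hom_ad.false g).elim
  | p s =>
    cases Z
    · exact Subsingleton.elim _ _
    · obtain ⟨s₁, rfl⟩ := hom_bb_eq g
      obtain ⟨s₂, rfl⟩ := hom_bb_eq g'
      have e : Hom.p (xor s s₁) = Hom.p (xor s s₂) := hgg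
      rw [xor_cancel_left (Hom.p.inj e)]
    · exact (isEmpty_hom_bc.false g).elim
    · exact (isEmpty_hom_bd.false g).elim
  | q t =>
    cases Z
    · obtain ⟨k₁, rfl⟩ := hom_ca_eq g
      obtain ⟨k₂, rfl⟩ := hom_ca_eq g'
      have e : Hom.r (.qh k₁) = Hom.r (.qh k₂) := hgg
      rw [R.qh.inj (Hom.r.inj e)]
    · exact (isEmpty_hom_cb.false g).elim
    · obtain ⟨t₁, rfl⟩ := hom_cc_eq g
      obtain ⟨t₂, rfl⟩ := hom_cc_eq g'
      have e : Hom.q (xor t t₁) = Hom.q (xor t t₂) := hgg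
      rw [xor_cancel_left (Hom.q.inj e)]
    · exact (isEmpty_hom_cd.false g).elim
  | r ρ =>
    cases Z
    · exact Subsingleton.elim _ _
    · exact (isEmpty_hom_ab.false g).elim
    · exact (isEmpty_hom_ac.false g).elim
    · exact (isEmpty_hom_ad.false g).elim

/-- `f : b → a` is NOT a monomorphism (`1 ≫ f = σ ≫ f`). [cite: MochizukiFrdII2008, Prop 3.5 (iii) p.34] -/
theorem not_mono_fHom : ¬ Mono fHom := fun hm =>
  sigma_hom_ne_id (hm.right_cancellation sigma.hom (𝟙 b) (Subsingleton.elim _ _))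

/-- `h_k : c → a` is NOT a monomorphism (`1 ≫ h_k = β ≫ h_k`). [cite: MochizukiFrdII2008, Prop 3.5 (iii) p.34] -/
theorem not_mono_hHom (k : Bool) : ¬ Mono (hHom k) := fun hm => by
  have e : beta.hom = 𝟙 c := hm.right_cancellation beta.hom (𝟙 c) rfl
  cases e

/-- **`f : b → a` is a categorical quotient of `b` by `Aut(b) = {1, σ}`** ([FrdI] §0): no arrow `b → b` is
`σ`-invariant, and `Hom(b, a) = {f}`, `End(a) = 1`. [cite: MochizukiFrdI2008, §0 p.18] -/
theorem isCategoricalQuotient_fHom : IsCategoricalQuotient (⊤ : Subgroup (Aut b)) fHom := by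
  refine ⟨fun γ _ => Subsingleton.elim _ _, fun X ψ hψ => ?_⟩
  cases X
  · exact ⟨𝟙 a, Subsingleton.elim _ _, fun _ _ => Subsingleton.elim _ _⟩
  · exfalso
    obtain ⟨s, rfl⟩ := hom_bb_eq ψ
    have e := hψ sigma (Subgroup.mem_top _)
    have e' : Hom.autB (xor true s) = Hom.autB s := e
    exact true_xor_ne s (Hom.autB.inj e')
  · exact (isEmpty_hom_bc.false ψ).elim
  · exact (isEmpty_hom_bd.false ψ).elim

/-- **`f : b → a` is a MONO-MINIMAL categorical quotient of `b` by `Aut(b)`**: a monomorphism out of `b` through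
which `f` factors is an automorphism of `b` (`f` itself is not mono; `Hom(b, c) = Hom(b, d) = ∅`).
[cite: MochizukiFrdI2008, §0 p.18] -/
theorem isMonoMinimalQuotient_fHom : IsMonoMinimalQuotient (⊤ : Subgroup (Aut b)) fHom := by
  refine ⟨isCategoricalQuotient_fHom, fun A' ζ φ' _ hmono _ => ?_⟩
  cases A'
  · exfalso
    have hζ : ζ = fHom := Subsingleton.elim _ _
    subst hζ
    exact not_mono_fHom hmono
  · obtain ⟨s, rfl⟩ := hom_bb_eq ζ
    exact ⟨⟨au s, (auIso s).hom_inv_id, (auIso s).inv_hom_id⟩⟩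
  · exact (isEmpty_hom_bc.false ζ).elim
  · exact (isEmpty_hom_bd.false ζ).elim

/-- In `S` every monomorphism with codomain `b`, `c` or `a` out of `d` fails to be fiberwise surjective, and
the remaining monomorphisms are automorphisms: **every FSM-morphism of `S` is an isomorphism** (`S` is of
FSM-type, [FrdI] §0). [cite: MochizukiFrdI2008, §0 p.14] -/
theorem isOfFSMType : IsOfFSMType S := by
  refine ⟨fun {X Y} φ hφ => ?_⟩
  obtain ⟨hfs, hmono⟩ := hφ
  cases φ with
  | autB s => exact ⟨⟨au s, (auIso s).hom_inv_id, (auIso s).inv_hom_id⟩⟩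
  | autC t => exact ⟨⟨cu t, (cuIso t).hom_inv_id, (cuIso t).inv_hom_id⟩⟩
  | ida => exact (inferInstance : IsIso (𝟙 a))
  | idd => exact (inferInstance : IsIso (𝟙 d))
  | f => exact (not_mono_fHom hmono).elim
  | h k => exact (not_mono_hHom k hmono).elim
  | p s =>
    -- `p ≫ σ^s` is not fiberwise surjective: the arrow `p ≫ σ^{¬s} : d → b` admits no completing square
    exfalso
    obtain ⟨W, δB, δX, e⟩ := hfs (pHom (!s))
    cases W
    · exact (isEmpty_hom_ad.false δB).elim
    · exact (isEmpty_hom_bd.false δB).elim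
    · exact (isEmpty_hom_cd.false δB).elim
    · have h1 : δB = 𝟙 d := Subsingleton.elim _ _
      have h2 : δX = 𝟙 d := Subsingleton.elim _ _
      subst h1; subst h2
      rw [Category.id_comp, Category.id_comp] at e
      exact Bool.not_ne_self s (Hom.p.inj e).symm
  | q t =>
    exfalso
    obtain ⟨W, δB, δX, e⟩ := hfs (qHom (!t))
    cases W
    · exact (isEmpty_hom_ad.false δB).elim
    · exact (isEmpty_hom_bd.false δB).elim
    · exact (isEmpty_hom_cd.false δB).elim
    · have h1 : δB = 𝟙 d := Subsingleton.elim _ _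
      have h2 : δX = 𝟙 d := Subsingleton.elim _ _
      subst h1; subst h2
      rw [Category.id_comp, Category.id_comp] at e
      exact Bool.not_ne_self t (Hom.q.inj e).symm
  | r ρ =>
    -- an arrow `d → a` is not fiberwise surjective: `f : b → a` (resp. `h : c → a`) has no completion through `d`
    exfalso
    cases ρ with
    | pf =>
      obtain ⟨W, δB, δX, e⟩ := hfs (hHom false)
      cases W
      · exact (isEmpty_hom_ad.false δB).elim
      · exact (isEmpty_hom_bd.false δB).elim
      · exact (isEmpty_hom_cd.false δB).elim
      · obtain ⟨t, rfl⟩ := hom_dc_eq δX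
        have h1 : δB = 𝟙 d := Subsingleton.elim _ _
        subst h1
        rw [Category.id_comp] at e
        have e' : Hom.r R.pf = Hom.r (R.qh false) := e
        cases e'
    | qh k =>
      obtain ⟨W, δB, δX, e⟩ := hfs fHom
      cases W
      · exact (isEmpty_hom_ad.false δB).elim
      · exact (isEmpty_hom_bd.false δB).elim
      · exact (isEmpty_hom_cd.false δB).elim
      · obtain ⟨s, rfl⟩ := hom_db_eq δX
        have h1 : δB = 𝟙 d := Subsingleton.elim _ _
        subst h1
        rw [Category.id_comp] at e
        have e' : Hom.r (R.qh k) = Hom.r R.pf := e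
        cases e'

end S

end P35iiiStd

end ArchFrd

end

end Literature.AlgebraicGeometry.Frobenioids
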